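import Mathlib.Analysis.ODE.Gronwall
import Literature.Analysis.FluidPDE.CompressibleEulerLinearizedEnergy
import Literature.Analysis.FunctionSpaces.TorusClassicalNSUniqueness
import HarnessLib

/-!
# Grönwall for the linearised symmetric Euler system on `𝕋^d`: `L²` continuous dependence and
# vanishing of solutions with zero data

Analysis/FluidPDE support file (everything proved), layer L6b of the programme to discharge
`Literature.Analysis.FluidPDE.CompressibleEulerLocalWellPosedness` (Majda 1984, Ch. 2,
Thms 2.1–2.2). It draws the Grönwall consequence of the integrated energy identity
`linearizedEnergy_hasDerivWithinAt` (`CompressibleEulerLinearizedEnergy.lean`) on a compact time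
interval `[t₀, t₁]`: if the weights `a, c, d₃` are bounded below by `δ > 0`, `d₃ g = c b`, and the
residuals `R₁, R₂, R₃` of the linearised system are pointwise `O(|r| + ‖w‖ + |θ|)` — the
situation of the DIFFERENCE of two solutions of the quasilinear system, and of two consecutive
iterates of Majda's scheme — then

* `linearizedEnergy_le_mul_exp` — `E(s) ≤ E(t₀) e^{K(s - t₀)}` on `[t₀, t₁]` for the energy
  `E = ∫ (a r² + c‖w‖² + d₃θ²)` and some constant `K` (Dafermos 2005, (5.1.22)–(5.1.23);
  Majda 1984, Ch. 2 §2.1, the basic `L²` energy estimate);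
* `linearized_vanishing` — if moreover `(r, w, θ)(t₀) = 0` then `(r, w, θ) ≡ 0` on `[t₀, t₁]`.

The only analytic inputs are the scalar bound `energyIntegrand_le` for the integrand of `E'`,
uniform bounds of smooth fields on the compact `[t₀, t₁] × 𝕋^d`
(`Torus.IsSmoothSpaceTimeOn.exists_norm_le_of_isCompact`), Mathlib's
`le_gronwallBound_of_liminf_deriv_right_le`, and `Torus.eq_zero_of_integral_norm_sq_nonpos`
(layout of `TorusClassicalNSUniqueness.lean`).

## References

* A. Majda, *Compressible Fluid Flow and Systems of Conservation Laws in Several Space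
  Variables*, Appl. Math. Sci. 53, Springer 1984, Ch. 2 §2.1 (Thm 2.1: uniqueness and the
  `L²` contraction (2.12)–(2.13) of the iteration scheme). [`Majda1984`]
* C. M. Dafermos, *Hyperbolic Conservation Laws in Continuum Physics*, 2nd ed. (2005), §5.1,
  (5.1.18)–(5.1.23). [`Dafermos2005`]
-/

noncomputable section

open Set Function Filter MeasureTheory
open scoped ContDiff _root_.Topology InnerProductSpace

namespace Literature.Analysis.FluidPDE

namespace CompressibleEuler

open Literature.Analysis.FunctionSpaces

/-! ## The scalar bound for the integrand of `E'` -/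

/-- **Pointwise bound of the energy-derivative integrand.** If `|a|, |c|, |d|, |A|, |C|, |D|,
|X|, |Y|, |Z| ≤ M`, `|P|, |Q| ≤ M‖w‖` and the residuals satisfy `|R₁|, ‖R₂‖, |R₃| ≤
L(|r| + ‖w‖ + |θ|)` with `L ≥ 0`, then
`2arR₁ + 2c⟪w,R₂⟫ + 2dθR₃ + (Ar² + C‖w‖² + Dθ²) + (r²X + ‖w‖²Y + θ²Z) + 2rP + 2θQ`
`≤ (18ML + 4M)(r² + ‖w‖² + θ²)` (Cauchy–Schwarz and `2xy ≤ x² + y²`). [folklore] -/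
theorem energyIntegrand_le {E : Type*} [NormedAddCommGroup E] [InnerProductSpace ℝ E]
    {r θ a c d A C D X Y Z P Q R₁ R₃ M L : ℝ} {w R₂ : E} (hL : 0 ≤ L)
    (ha : |a| ≤ M) (hc : |c| ≤ M) (hd : |d| ≤ M) (hA : |A| ≤ M) (hC : |C| ≤ M) (hD : |D| ≤ M)
    (hX : |X| ≤ M) (hY : |Y| ≤ M) (hZ : |Z| ≤ M) (hP : |P| ≤ M * ‖w‖) (hQ : |Q| ≤ M * ‖w‖)
    (h1 : |R₁| ≤ L * (|r| + ‖w‖ + |θ|)) (h2 : ‖R₂‖ ≤ L * (|r| + ‖w‖ + |θ|))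
    (h3 : |R₃| ≤ L * (|r| + ‖w‖ + |θ|)) :
    2 * a * r * R₁ + 2 * c * ⟪w, R₂⟫_ℝ + 2 * d * θ * R₃ + (A * r ^ 2 + C * ‖w‖ ^ 2 + D * θ ^ 2) +
        (r ^ 2 * X + ‖w‖ ^ 2 * Y + θ ^ 2 * Z) + 2 * r * P + 2 * θ * Q ≤
      (18 * M * L + 4 * M) * (r ^ 2 + ‖w‖ ^ 2 + θ ^ 2) := by
  have hM : 0 ≤ M := (abs_nonneg a).trans ha
  set s := |r| + ‖w‖ + |θ| with hs
  set q := r ^ 2 + ‖w‖ ^ 2 + θ ^ 2 with hq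
  have hw0 : 0 ≤ ‖w‖ := norm_nonneg _
  have hr0 : 0 ≤ |r| := abs_nonneg _
  have hθ0 : 0 ≤ |θ| := abs_nonneg _
  have hs0 : 0 ≤ s := by positivity
  have hr2 : |r| ^ 2 = r ^ 2 := sq_abs r
  have hθ2 : |θ| ^ 2 = θ ^ 2 := sq_abs θ
  have hs2 : s ^ 2 ≤ 3 * q := by
    rw [hs, hq, ← hr2, ← hθ2]
    nlinarith [sq_nonneg (|r| - ‖w‖), sq_nonneg (|r| - |θ|), sq_nonneg (‖w‖ - |θ|)]
  have hrs : |r| ≤ s := by rw [hs]; linarith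
  have hws : ‖w‖ ≤ s := by rw [hs]; linarith
  have hθs : |θ| ≤ s := by rw [hs]; linarith
  have hMLs : 2 * M * L * s ^ 2 ≤ 6 * M * L * q :=
    calc 2 * M * L * s ^ 2 = (2 * M * L) * s ^ 2 := by ring
      _ ≤ (2 * M * L) * (3 * q) := mul_le_mul_of_nonneg_left hs2 (by positivity)
      _ = 6 * M * L * q := by ring
  -- (1) `2 a r R₁`
  have e1 : 2 * a * r * R₁ ≤ 6 * M * L * q := by
    have h : |2 * a * r * R₁| ≤ 2 * M * L * s ^ 2 := by
      rw [abs_mul, abs_mul, abs_mul, abs_two]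
      calc 2 * |a| * |r| * |R₁| = 2 * (|a| * |r|) * |R₁| := by ring
        _ ≤ 2 * (M * s) * (L * s) := by gcongr
        _ = 2 * M * L * s ^ 2 := by ring
    linarith [le_abs_self (2 * a * r * R₁)]
  -- (2) `2 c ⟪w, R₂⟫`
  have e2 : 2 * c * ⟪w, R₂⟫_ℝ ≤ 6 * M * L * q := by
    have h : |2 * c * ⟪w, R₂⟫_ℝ| ≤ 2 * M * L * s ^ 2 := by
      rw [abs_mul, abs_mul, abs_two]
      calc 2 * |c| * |⟪w, R₂⟫_ℝ| ≤ 2 * M * (‖w‖ * ‖R₂‖) := by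
            gcongr
            exact abs_real_inner_le_norm _ _
        _ ≤ 2 * M * (s * (L * s)) := by gcongr
        _ = 2 * M * L * s ^ 2 := by ring
    linarith [le_abs_self (2 * c * ⟪w, R₂⟫_ℝ)]
  -- (3) `2 d θ R₃`
  have e3 : 2 * d * θ * R₃ ≤ 6 * M * L * q := by
    have h : |2 * d * θ * R₃| ≤ 2 * M * L * s ^ 2 := by
      rw [abs_mul, abs_mul, abs_mul, abs_two]
      calc 2 * |d| * |θ| * |R₃| = 2 * (|d| * |θ|) * |R₃| := by ring
        _ ≤ 2 * (M * s) * (L * s) := by gcongr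
        _ = 2 * M * L * s ^ 2 := by ring
    linarith [le_abs_self (2 * d * θ * R₃)]
  -- (4) `A r² + C ‖w‖² + D θ²`
  have e4 : A * r ^ 2 + C * ‖w‖ ^ 2 + D * θ ^ 2 ≤ M * q := by
    have i1 : A * r ^ 2 ≤ M * r ^ 2 := mul_le_mul_of_nonneg_right ((le_abs_self A).trans hA) (sq_nonneg r)
    have i2 : C * ‖w‖ ^ 2 ≤ M * ‖w‖ ^ 2 :=
      mul_le_mul_of_nonneg_right ((le_abs_self C).trans hC) (sq_nonneg ‖w‖)
    have i3 : D * θ ^ 2 ≤ M * θ ^ 2 := mul_le_mul_of_nonneg_right ((le_abs_self D).trans hD) (sq_nonneg θ)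
    rw [hq]; linarith
  -- (5) `r² X + ‖w‖² Y + θ² Z`
  have e5 : r ^ 2 * X + ‖w‖ ^ 2 * Y + θ ^ 2 * Z ≤ M * q := by
    have i1 : r ^ 2 * X ≤ r ^ 2 * M := mul_le_mul_of_nonneg_left ((le_abs_self X).trans hX) (sq_nonneg r)
    have i2 : ‖w‖ ^ 2 * Y ≤ ‖w‖ ^ 2 * M :=
      mul_le_mul_of_nonneg_left ((le_abs_self Y).trans hY) (sq_nonneg ‖w‖)
    have i3 : θ ^ 2 * Z ≤ θ ^ 2 * M := mul_le_mul_of_nonneg_left ((le_abs_self Z).trans hZ) (sq_nonneg θ)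
    rw [hq]; linarith
  -- (6) `2 r P`
  have e6 : 2 * r * P ≤ M * q := by
    have h : |2 * r * P| ≤ 2 * |r| * (M * ‖w‖) := by
      rw [abs_mul, abs_mul, abs_two]
      gcongr
    have hθq : r ^ 2 + ‖w‖ ^ 2 ≤ q := by rw [hq]; linarith [sq_nonneg θ]
    have h' : 2 * |r| * (M * ‖w‖) ≤ M * q :=
      calc 2 * |r| * (M * ‖w‖) = M * (2 * |r| * ‖w‖) := by ring
        _ ≤ M * (|r| ^ 2 + ‖w‖ ^ 2) := mul_le_mul_of_nonneg_left (two_mul_le_add_sq _ _) hM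
        _ = M * (r ^ 2 + ‖w‖ ^ 2) := by rw [hr2]
        _ ≤ M * q := mul_le_mul_of_nonneg_left hθq hM
    linarith [le_abs_self (2 * r * P)]
  -- (7) `2 θ Q`
  have e7 : 2 * θ * Q ≤ M * q := by
    have h : |2 * θ * Q| ≤ 2 * |θ| * (M * ‖w‖) := by
      rw [abs_mul, abs_mul, abs_two]
      gcongr
    have hrq : θ ^ 2 + ‖w‖ ^ 2 ≤ q := by rw [hq]; linarith [sq_nonneg r]
    have h' : 2 * |θ| * (M * ‖w‖) ≤ M * q :=
      calc 2 * |θ| * (M * ‖w‖) = M * (2 * |θ| * ‖w‖) := by ring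
        _ ≤ M * (|θ| ^ 2 + ‖w‖ ^ 2) := mul_le_mul_of_nonneg_left (two_mul_le_add_sq _ _) hM
        _ = M * (θ ^ 2 + ‖w‖ ^ 2) := by rw [hθ2]
        _ ≤ M * q := mul_le_mul_of_nonneg_left hrq hM
    linarith [le_abs_self (2 * θ * Q)]
  have htot : (18 * M * L + 4 * M) * (r ^ 2 + ‖w‖ ^ 2 + θ ^ 2) =
      6 * M * L * q + 6 * M * L * q + 6 * M * L * q + M * q + M * q + M * q + M * q := by
    rw [hq]; ring
  rw [htot]
  linarith

/-- `|∑ᵢ wᵢ mᵢ| ≤ (∑ᵢ |mᵢ|) ‖w‖` for `w ∈ ℝ^d` (`|wᵢ| ≤ ‖w‖`). [folklore] -/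
theorem abs_sum_coord_mul_le {d : Type*} [Fintype d] (w : EuclideanSpace ℝ d) (m : d → ℝ) :
    |∑ i, w i * m i| ≤ (∑ i, |m i|) * ‖w‖ := by
  calc |∑ i, w i * m i| ≤ ∑ i, |w i * m i| := Finset.abs_sum_le_sum_abs _ _
    _ = ∑ i, |w i| * |m i| := by simp_rw [abs_mul]
    _ ≤ ∑ i, ‖w‖ * |m i| := by
        refine Finset.sum_le_sum fun i _ => ?_
        have hi : |w i| ≤ ‖w‖ := by
          have := PiLp.norm_apply_le w i
          rwa [Real.norm_eq_abs] at this
        exact mul_le_mul_of_nonneg_right hi (abs_nonneg _)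
    _ = (∑ i, |m i|) * ‖w‖ := by rw [Finset.sum_mul]; simp_rw [mul_comm]

/-! ## Grönwall on a compact time interval -/

section Gronwall

variable {d : Type*} [Fintype d] [DecidableEq d] {t₀ t₁ : ℝ}
  {r θ a b c g d₃ : ℝ → UnitAddTorus d → ℝ} {w v : ℝ → UnitAddTorus d → EuclideanSpace ℝ d}

/-- **`L²` continuous dependence for the linearised symmetric Euler system (Grönwall).** Let
`r, θ, w, v, a, c, g, d₃` be jointly smooth on `[t₀, t₁] × 𝕋^d`, `t₀ < t₁`, `b` arbitrary, with
`d₃ g = c b`, weights `a, c, d₃ ≥ δ > 0`, and residuals of the linearised system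
`R₁ = ∂ₜr + ∑ᵢvᵢ∂ᵢr + c div w`, `R₂ = ∂ₜw + ∑ᵢvᵢ∂ᵢw + a∇r + b∇θ`, `R₃ = ∂ₜθ + ∑ᵢvᵢ∂ᵢθ + g div w`
bounded pointwise by `L(|r| + ‖w‖ + |θ|)`, `L ≥ 0`. Then the energy
`E(s) = ∫ (a r² + c‖w‖² + d₃θ²)(s, x) dx` satisfies `E(s) ≤ E(t₀) e^{K(s - t₀)}` on `[t₀, t₁]`
for some constant `K` (`E' ≤ (K₀/δ) E` by `linearizedEnergy_hasDerivWithinAt` and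
`energyIntegrand_le` with the uniform bounds of the coefficient fields on the compact
`[t₀, t₁] × 𝕋^d`, then Grönwall) (Dafermos 2005, (5.1.22)–(5.1.23); Majda 1984, Ch. 2 §2.1).
[cite: Majda1984, Ch. 2 §2.1] -/
theorem linearizedEnergy_le_mul_exp (ht : t₀ < t₁)
    (hr : FunctionSpaces.Torus.IsSmoothSpaceTimeOn (Icc t₀ t₁) r)
    (hθ : FunctionSpaces.Torus.IsSmoothSpaceTimeOn (Icc t₀ t₁) θ)
    (hw : FunctionSpaces.Torus.IsSmoothSpaceTimeOn (Icc t₀ t₁) w)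
    (hv : FunctionSpaces.Torus.IsSmoothSpaceTimeOn (Icc t₀ t₁) v)
    (ha : FunctionSpaces.Torus.IsSmoothSpaceTimeOn (Icc t₀ t₁) a)
    (hc : FunctionSpaces.Torus.IsSmoothSpaceTimeOn (Icc t₀ t₁) c)
    (hg : FunctionSpaces.Torus.IsSmoothSpaceTimeOn (Icc t₀ t₁) g)
    (hd : FunctionSpaces.Torus.IsSmoothSpaceTimeOn (Icc t₀ t₁) d₃)
    (hm : ∀ s ∈ Icc t₀ t₁, ∀ x, d₃ s x * g s x = c s x * b s x)
    {δ : ℝ} (hδ : 0 < δ) (hδa : ∀ s ∈ Icc t₀ t₁, ∀ x, δ ≤ a s x)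
    (hδc : ∀ s ∈ Icc t₀ t₁, ∀ x, δ ≤ c s x) (hδd : ∀ s ∈ Icc t₀ t₁, ∀ x, δ ≤ d₃ s x)
    {L : ℝ} (hL : 0 ≤ L)
    (hR : ∀ s ∈ Icc t₀ t₁, ∀ x,
      |FunctionSpaces.Torus.timeDerivWithin (Icc t₀ t₁) r s x +
          (∑ i, v s x i * FunctionSpaces.Torus.partialDeriv i (r s) x) +
          c s x * FunctionSpaces.Torus.divergence (w s) x| ≤ L * (|r s x| + ‖w s x‖ + |θ s x|) ∧
      ‖FunctionSpaces.Torus.timeDerivWithin (Icc t₀ t₁) w s x +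
          (∑ i, v s x i • FunctionSpaces.Torus.partialDeriv i (w s) x) +
          a s x • FunctionSpaces.Torus.gradient (r s) x +
          b s x • FunctionSpaces.Torus.gradient (θ s) x‖ ≤ L * (|r s x| + ‖w s x‖ + |θ s x|) ∧
      |FunctionSpaces.Torus.timeDerivWithin (Icc t₀ t₁) θ s x +
          (∑ i, v s x i * FunctionSpaces.Torus.partialDeriv i (θ s) x) +
          g s x * FunctionSpaces.Torus.divergence (w s) x| ≤ L * (|r s x| + ‖w s x‖ + |θ s x|)) :
    ∃ K : ℝ, ∀ s ∈ Icc t₀ t₁,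
      ∫ x, (a s x * r s x ^ 2 + c s x * ‖w s x‖ ^ 2 + d₃ s x * θ s x ^ 2) ≤
        (∫ x, (a t₀ x * r t₀ x ^ 2 + c t₀ x * ‖w t₀ x‖ ^ 2 + d₃ t₀ x * θ t₀ x ^ 2)) *
          Real.exp (K * (s - t₀)) := by
  classical
  have hU : UniqueDiffOn ℝ (Icc t₀ t₁) := uniqueDiffOn_Icc ht
  have hconv : Convex ℝ (Icc t₀ t₁) := convex_Icc t₀ t₁
  -- uniform bounds of the coefficient-type fields on the compact slab
  obtain ⟨Ca, hCa⟩ := ha.exists_norm_le_of_isCompact isCompact_Icc subset_rfl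
  obtain ⟨Cc, hCc⟩ := hc.exists_norm_le_of_isCompact isCompact_Icc subset_rfl
  obtain ⟨Cd, hCd⟩ := hd.exists_norm_le_of_isCompact isCompact_Icc subset_rfl
  obtain ⟨CA, hCA⟩ := (ha.timeDerivWithin hU).exists_norm_le_of_isCompact isCompact_Icc subset_rfl
  obtain ⟨CC, hCC⟩ := (hc.timeDerivWithin hU).exists_norm_le_of_isCompact isCompact_Icc subset_rfl
  obtain ⟨CD, hCD⟩ := (hd.timeDerivWithin hU).exists_norm_le_of_isCompact isCompact_Icc subset_rfl
  obtain ⟨CX, hCX⟩ := ((ha.smul hv).divergence hU).exists_norm_le_of_isCompact isCompact_Icc subset_rfl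
  obtain ⟨CY, hCY⟩ := ((hc.smul hv).divergence hU).exists_norm_le_of_isCompact isCompact_Icc subset_rfl
  obtain ⟨CZ, hCZ⟩ := ((hd.smul hv).divergence hU).exists_norm_le_of_isCompact isCompact_Icc subset_rfl
  have hPi : ∀ i : d, ∃ C : ℝ, ∀ s ∈ Icc t₀ t₁, ∀ x,
      ‖FunctionSpaces.Torus.partialDeriv i (fun y => a s y * c s y) x‖ ≤ C := fun i =>
    ((ha.mul hc).partialDeriv hU i).exists_norm_le_of_isCompact isCompact_Icc subset_rfl
  choose CP hCP using hPi
  have hQi : ∀ i : d, ∃ C : ℝ, ∀ s ∈ Icc t₀ t₁, ∀ x,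
      ‖FunctionSpaces.Torus.partialDeriv i (fun y => d₃ s y * g s y) x‖ ≤ C := fun i =>
    ((hd.mul hg).partialDeriv hU i).exists_norm_le_of_isCompact isCompact_Icc subset_rfl
  choose CQ hCQ using hQi
  -- one constant to rule them all
  set M : ℝ := |Ca| + |Cc| + |Cd| + |CA| + |CC| + |CD| + |CX| + |CY| + |CZ| +
    (∑ i, |CP i|) + (∑ i, |CQ i|) with hMdef
  have hP0 : 0 ≤ ∑ i, |CP i| := Finset.sum_nonneg fun i _ => abs_nonneg _
  have hQ0 : 0 ≤ ∑ i, |CQ i| := Finset.sum_nonneg fun i _ => abs_nonneg _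
  have hnn := fun y : ℝ => abs_nonneg y
  have hM0 : 0 ≤ M := by
    rw [hMdef]
    linarith [hnn Ca, hnn Cc, hnn Cd, hnn CA, hnn CC, hnn CD, hnn CX, hnn CY, hnn CZ]
  have bnd : ∀ {y C : ℝ}, |y| ≤ C → |C| ≤ M → |y| ≤ M := fun h hCM => (h.trans (le_abs_self _)).trans hCM
  have mCa : |Ca| ≤ M := by
    rw [hMdef]; linarith [hnn Cc, hnn Cd, hnn CA, hnn CC, hnn CD, hnn CX, hnn CY, hnn CZ]
  have mCc : |Cc| ≤ M := by
    rw [hMdef]; linarith [hnn Ca, hnn Cd, hnn CA, hnn CC, hnn CD, hnn CX, hnn CY, hnn CZ]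
  have mCd : |Cd| ≤ M := by
    rw [hMdef]; linarith [hnn Ca, hnn Cc, hnn CA, hnn CC, hnn CD, hnn CX, hnn CY, hnn CZ]
  have mCA : |CA| ≤ M := by
    rw [hMdef]; linarith [hnn Ca, hnn Cc, hnn Cd, hnn CC, hnn CD, hnn CX, hnn CY, hnn CZ]
  have mCC : |CC| ≤ M := by
    rw [hMdef]; linarith [hnn Ca, hnn Cc, hnn Cd, hnn CA, hnn CD, hnn CX, hnn CY, hnn CZ]
  have mCD : |CD| ≤ M := by
    rw [hMdef]; linarith [hnn Ca, hnn Cc, hnn Cd, hnn CA, hnn CC, hnn CX, hnn CY, hnn CZ]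
  have mCX : |CX| ≤ M := by
    rw [hMdef]; linarith [hnn Ca, hnn Cc, hnn Cd, hnn CA, hnn CC, hnn CD, hnn CY, hnn CZ]
  have mCY : |CY| ≤ M := by
    rw [hMdef]; linarith [hnn Ca, hnn Cc, hnn Cd, hnn CA, hnn CC, hnn CD, hnn CX, hnn CZ]
  have mCZ : |CZ| ≤ M := by
    rw [hMdef]; linarith [hnn Ca, hnn Cc, hnn Cd, hnn CA, hnn CC, hnn CD, hnn CX, hnn CY]
  have mCP : ∑ i, |CP i| ≤ M := by
    rw [hMdef]; linarith [hnn Ca, hnn Cc, hnn Cd, hnn CA, hnn CC, hnn CD, hnn CX, hnn CY, hnn CZ]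
  have mCQ : ∑ i, |CQ i| ≤ M := by
    rw [hMdef]; linarith [hnn Ca, hnn Cc, hnn Cd, hnn CA, hnn CC, hnn CD, hnn CX, hnn CY, hnn CZ]
  -- the energy, its derivative, and the comparison function
  set e : ℝ → UnitAddTorus d → ℝ := fun s x => a s x * r s x ^ 2 + c s x * ‖w s x‖ ^ 2 + d₃ s x * θ s x ^ 2
    with hedef
  set En : ℝ → ℝ := fun s => ∫ x, e s x with hEndef
  set q : ℝ → UnitAddTorus d → ℝ := fun s x => r s x ^ 2 + ‖w s x‖ ^ 2 + θ s x ^ 2 with hqdef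
  set K₀ : ℝ := 18 * M * L + 4 * M with hK₀
  have hK₀0 : 0 ≤ K₀ := by rw [hK₀]; positivity
  have hest : FunctionSpaces.Torus.IsSmoothSpaceTimeOn (Icc t₀ t₁) e := by
    have hw2 : FunctionSpaces.Torus.IsSmoothSpaceTimeOn (Icc t₀ t₁) (fun s y => ‖w s y‖ ^ 2) := by
      change ContDiffOn ℝ ∞ (fun z => ‖FunctionSpaces.Torus.stLift w z‖ ^ 2) _
      exact hw.norm_sq ℝ
    have hr2 : FunctionSpaces.Torus.IsSmoothSpaceTimeOn (Icc t₀ t₁) (fun s y => r s y ^ 2) := hr.pow 2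
    have hθ2 : FunctionSpaces.Torus.IsSmoothSpaceTimeOn (Icc t₀ t₁) (fun s y => θ s y ^ 2) := hθ.pow 2
    exact ((ha.mul hr2).add (hc.mul hw2)).add (hd.mul hθ2)
  -- pointwise: `δ q ≤ e`
  have hqe : ∀ s ∈ Icc t₀ t₁, ∀ x, δ * q s x ≤ e s x := fun s hs x => by
    simp only [hqdef, hedef]
    have h1 := mul_le_mul_of_nonneg_right (hδa s hs x) (sq_nonneg (r s x))
    have h2 := mul_le_mul_of_nonneg_right (hδc s hs x) (sq_nonneg ‖w s x‖)
    have h3 := mul_le_mul_of_nonneg_right (hδd s hs x) (sq_nonneg (θ s x))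
    linarith
  -- the derivative of the energy and its bound
  have hderiv : ∀ s ∈ Icc t₀ t₁, ∃ D : ℝ, HasDerivWithinAt En D (Icc t₀ t₁) s ∧ D ≤ (K₀ / δ) * En s := by
    intro s hs
    have hD := linearizedEnergy_hasDerivWithinAt hr hθ hw hv ha hc hg hd hconv hU hs (hm s hs)
    refine ⟨_, hD, ?_⟩
    -- pointwise bound of the integrand by `K₀ q`
    have hpt : ∀ x, 2 * a s x * r s x * (FunctionSpaces.Torus.timeDerivWithin (Icc t₀ t₁) r s x +
          (∑ i, v s x i * FunctionSpaces.Torus.partialDeriv i (r s) x) +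
          c s x * FunctionSpaces.Torus.divergence (w s) x) +
        2 * c s x * ⟪w s x, FunctionSpaces.Torus.timeDerivWithin (Icc t₀ t₁) w s x +
          (∑ i, v s x i • FunctionSpaces.Torus.partialDeriv i (w s) x) +
          a s x • FunctionSpaces.Torus.gradient (r s) x + b s x • FunctionSpaces.Torus.gradient (θ s) x⟫_ℝ +
        2 * d₃ s x * θ s x * (FunctionSpaces.Torus.timeDerivWithin (Icc t₀ t₁) θ s x +
          (∑ i, v s x i * FunctionSpaces.Torus.partialDeriv i (θ s) x) +
          g s x * FunctionSpaces.Torus.divergence (w s) x) +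
        (FunctionSpaces.Torus.timeDerivWithin (Icc t₀ t₁) a s x * r s x ^ 2 +
          FunctionSpaces.Torus.timeDerivWithin (Icc t₀ t₁) c s x * ‖w s x‖ ^ 2 +
          FunctionSpaces.Torus.timeDerivWithin (Icc t₀ t₁) d₃ s x * θ s x ^ 2) +
        (r s x ^ 2 * FunctionSpaces.Torus.divergence (fun y => a s y • v s y) x +
          ‖w s x‖ ^ 2 * FunctionSpaces.Torus.divergence (fun y => c s y • v s y) x +
          θ s x ^ 2 * FunctionSpaces.Torus.divergence (fun y => d₃ s y • v s y) x) +
        2 * r s x * (∑ i, w s x i * FunctionSpaces.Torus.partialDeriv i (fun y => a s y * c s y) x) +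
        2 * θ s x * (∑ i, w s x i * FunctionSpaces.Torus.partialDeriv i (fun y => d₃ s y * g s y) x) ≤
        K₀ * q s x := by
      intro x
      obtain ⟨h1, h2, h3⟩ := hR s hs x
      have e := energyIntegrand_le (r := r s x) (θ := θ s x) (w := w s x) hL
        (bnd (by simpa [Real.norm_eq_abs] using hCa s hs x) mCa)
        (bnd (by simpa [Real.norm_eq_abs] using hCc s hs x) mCc)
        (bnd (by simpa [Real.norm_eq_abs] using hCd s hs x) mCd)
        (bnd (by simpa [Real.norm_eq_abs] using hCA s hs x) mCA)
        (bnd (by simpa [Real.norm_eq_abs] using hCC s hs x) mCC)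
        (bnd (by simpa [Real.norm_eq_abs] using hCD s hs x) mCD)
        (bnd (by simpa [Real.norm_eq_abs] using hCX s hs x) mCX)
        (bnd (by simpa [Real.norm_eq_abs] using hCY s hs x) mCY)
        (bnd (by simpa [Real.norm_eq_abs] using hCZ s hs x) mCZ)
        (P := ∑ i, w s x i * FunctionSpaces.Torus.partialDeriv i (fun y => a s y * c s y) x)
        (Q := ∑ i, w s x i * FunctionSpaces.Torus.partialDeriv i (fun y => d₃ s y * g s y) x)
        ((abs_sum_coord_mul_le _ _).trans (mul_le_mul_of_nonneg_right
          ((Finset.sum_le_sum fun i _ =>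
            (by simpa [Real.norm_eq_abs] using hCP i s hs x :
              |FunctionSpaces.Torus.partialDeriv i (fun y => a s y * c s y) x| ≤ CP i).trans
              (le_abs_self _)).trans mCP)
          (norm_nonneg _)))
        ((abs_sum_coord_mul_le _ _).trans (mul_le_mul_of_nonneg_right
          ((Finset.sum_le_sum fun i _ =>
            (by simpa [Real.norm_eq_abs] using hCQ i s hs x :
              |FunctionSpaces.Torus.partialDeriv i (fun y => d₃ s y * g s y) x| ≤ CQ i).trans
              (le_abs_self _)).trans mCQ)
          (norm_nonneg _)))
        h1 h2 h3
      simpa only [hqdef, hK₀] using e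
    -- integrate
    have hqs : FunctionSpaces.Torus.IsSmooth (q s) := by
      have h1 : FunctionSpaces.Torus.IsSmooth (fun x => r s x ^ 2) := (hr.isSmooth_slice hs).pow 2
      have h2 : FunctionSpaces.Torus.IsSmooth (fun x => ‖w s x‖ ^ 2) := (hw.isSmooth_slice hs).norm_sq
      have h3 : FunctionSpaces.Torus.IsSmooth (fun x => θ s x ^ 2) := (hθ.isSmooth_slice hs).pow 2
      exact (h1.add h2).add h3
    have hKq : Integrable (fun x => K₀ * q s x) := hqs.integrable.const_mul K₀
    have hNE : ∫ x, K₀ * q s x ≤ (K₀ / δ) * En s := by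
      rw [integral_const_mul]
      have hle : ∫ x, q s x ≤ δ⁻¹ * En s := by
        rw [hEndef]
        simp only
        rw [← integral_const_mul]
        refine integral_mono hqs.integrable ((hest.isSmooth_slice hs).integrable.const_mul δ⁻¹)
          fun x => ?_
        · have := hqe s hs x
          rw [le_inv_mul_iff₀ hδ]
          simpa [hqdef, hedef] using this
      calc K₀ * ∫ x, q s x ≤ K₀ * (δ⁻¹ * En s) := mul_le_mul_of_nonneg_left hle hK₀0
        _ = K₀ / δ * En s := by ring
    by_cases hint : Integrable (fun x => 2 * a s x * r s x *
          (FunctionSpaces.Torus.timeDerivWithin (Icc t₀ t₁) r s x +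
          (∑ i, v s x i * FunctionSpaces.Torus.partialDeriv i (r s) x) +
          c s x * FunctionSpaces.Torus.divergence (w s) x) +
        2 * c s x * ⟪w s x, FunctionSpaces.Torus.timeDerivWithin (Icc t₀ t₁) w s x +
          (∑ i, v s x i • FunctionSpaces.Torus.partialDeriv i (w s) x) +
          a s x • FunctionSpaces.Torus.gradient (r s) x + b s x • FunctionSpaces.Torus.gradient (θ s) x⟫_ℝ +
        2 * d₃ s x * θ s x * (FunctionSpaces.Torus.timeDerivWithin (Icc t₀ t₁) θ s x +
          (∑ i, v s x i * FunctionSpaces.Torus.partialDeriv i (θ s) x) +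
          g s x * FunctionSpaces.Torus.divergence (w s) x) +
        (FunctionSpaces.Torus.timeDerivWithin (Icc t₀ t₁) a s x * r s x ^ 2 +
          FunctionSpaces.Torus.timeDerivWithin (Icc t₀ t₁) c s x * ‖w s x‖ ^ 2 +
          FunctionSpaces.Torus.timeDerivWithin (Icc t₀ t₁) d₃ s x * θ s x ^ 2) +
        (r s x ^ 2 * FunctionSpaces.Torus.divergence (fun y => a s y • v s y) x +
          ‖w s x‖ ^ 2 * FunctionSpaces.Torus.divergence (fun y => c s y • v s y) x +
          θ s x ^ 2 * FunctionSpaces.Torus.divergence (fun y => d₃ s y • v s y) x) +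
        2 * r s x * (∑ i, w s x i * FunctionSpaces.Torus.partialDeriv i (fun y => a s y * c s y) x) +
        2 * θ s x * (∑ i, w s x i * FunctionSpaces.Torus.partialDeriv i (fun y => d₃ s y * g s y) x))
    · exact (integral_mono hint hKq hpt).trans hNE
    · rw [integral_undef hint]
      have hEn0 : 0 ≤ En s := by
        rw [hEndef]
        exact integral_nonneg fun x => le_trans (mul_nonneg hδ.le (by simp only [hqdef]; positivity))
          (hqe s hs x)
      have : 0 ≤ K₀ / δ := div_nonneg hK₀0 hδ.le
      positivity
  -- Grönwall
  choose! D hD using hderiv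
  have hEc : ContinuousOn En (Icc t₀ t₁) := fun s hs => (hD s hs).1.continuousWithinAt
  have hder : ∀ s ∈ Ico t₀ t₁, HasDerivWithinAt En (D s) (Ici s) s := fun s hs =>
    ((hD s (Ico_subset_Icc_self hs)).1.mono (Icc_subset_Icc hs.1 le_rfl)).mono_of_mem_nhdsWithin
      (Icc_mem_nhdsGE hs.2)
  have hgr := le_gronwallBound_of_liminf_deriv_right_le (f := En) (f' := D) (δ := En t₀)
    (K := K₀ / δ) (ε := 0) (a := t₀) (b := t₁) hEc
    (fun s hs ρ hρ => (hder s hs).liminf_right_slope_le hρ) le_rfl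
    (fun s hs => by rw [add_zero]; exact (hD s (Ico_subset_Icc_self hs)).2)
  refine ⟨K₀ / δ, fun s hs => ?_⟩
  have h := hgr s hs
  rw [gronwallBound_ε0] at h
  simpa [hEndef, hedef] using h

/-- **Vanishing of solutions of the linearised system with zero data.** Under the hypotheses of
`linearizedEnergy_le_mul_exp`, if `r(t₀) = 0`, `w(t₀) = 0`, `θ(t₀) = 0` then `r, w, θ` vanish
identically on `[t₀, t₁]` (`E(t₀) = 0`, so `E ≡ 0`, and `δ ∫ (r² + ‖w‖² + θ²) ≤ E`; a smooth
field with `∫ ‖·‖² ≤ 0` vanishes). This is the uniqueness mechanism of Majda 1984, Thm 2.1 /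
Dafermos 2005, Thm 5.1.1 for classical solutions, and the identification step of every restart
argument. [cite: Majda1984, Ch. 2 §2.1 Thm 2.1] -/
theorem linearized_vanishing (ht : t₀ < t₁)
    (hr : FunctionSpaces.Torus.IsSmoothSpaceTimeOn (Icc t₀ t₁) r)
    (hθ : FunctionSpaces.Torus.IsSmoothSpaceTimeOn (Icc t₀ t₁) θ)
    (hw : FunctionSpaces.Torus.IsSmoothSpaceTimeOn (Icc t₀ t₁) w)
    (hv : FunctionSpaces.Torus.IsSmoothSpaceTimeOn (Icc t₀ t₁) v)
    (ha : FunctionSpaces.Torus.IsSmoothSpaceTimeOn (Icc t₀ t₁) a)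
    (hc : FunctionSpaces.Torus.IsSmoothSpaceTimeOn (Icc t₀ t₁) c)
    (hg : FunctionSpaces.Torus.IsSmoothSpaceTimeOn (Icc t₀ t₁) g)
    (hd : FunctionSpaces.Torus.IsSmoothSpaceTimeOn (Icc t₀ t₁) d₃)
    (hm : ∀ s ∈ Icc t₀ t₁, ∀ x, d₃ s x * g s x = c s x * b s x)
    {δ : ℝ} (hδ : 0 < δ) (hδa : ∀ s ∈ Icc t₀ t₁, ∀ x, δ ≤ a s x)
    (hδc : ∀ s ∈ Icc t₀ t₁, ∀ x, δ ≤ c s x) (hδd : ∀ s ∈ Icc t₀ t₁, ∀ x, δ ≤ d₃ s x)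
    {L : ℝ} (hL : 0 ≤ L)
    (hR : ∀ s ∈ Icc t₀ t₁, ∀ x,
      |FunctionSpaces.Torus.timeDerivWithin (Icc t₀ t₁) r s x +
          (∑ i, v s x i * FunctionSpaces.Torus.partialDeriv i (r s) x) +
          c s x * FunctionSpaces.Torus.divergence (w s) x| ≤ L * (|r s x| + ‖w s x‖ + |θ s x|) ∧
      ‖FunctionSpaces.Torus.timeDerivWithin (Icc t₀ t₁) w s x +
          (∑ i, v s x i • FunctionSpaces.Torus.partialDeriv i (w s) x) +
          a s x • FunctionSpaces.Torus.gradient (r s) x +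
          b s x • FunctionSpaces.Torus.gradient (θ s) x‖ ≤ L * (|r s x| + ‖w s x‖ + |θ s x|) ∧
      |FunctionSpaces.Torus.timeDerivWithin (Icc t₀ t₁) θ s x +
          (∑ i, v s x i * FunctionSpaces.Torus.partialDeriv i (θ s) x) +
          g s x * FunctionSpaces.Torus.divergence (w s) x| ≤ L * (|r s x| + ‖w s x‖ + |θ s x|))
    (h0r : r t₀ = 0) (h0w : w t₀ = 0) (h0θ : θ t₀ = 0) :
    ∀ s ∈ Icc t₀ t₁, r s = 0 ∧ w s = 0 ∧ θ s = 0 := by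
  obtain ⟨K, hK⟩ := linearizedEnergy_le_mul_exp ht hr hθ hw hv ha hc hg hd hm hδ hδa hδc hδd hL hR
  intro s hs
  have hE0 : ∫ x, (a t₀ x * r t₀ x ^ 2 + c t₀ x * ‖w t₀ x‖ ^ 2 + d₃ t₀ x * θ t₀ x ^ 2) = 0 := by
    simp [h0r, h0w, h0θ]
  have hEs : ∫ x, (a s x * r s x ^ 2 + c s x * ‖w s x‖ ^ 2 + d₃ s x * θ s x ^ 2) ≤ 0 := by
    have := hK s hs
    rwa [hE0, zero_mul] at this
  -- smoothness of the slices
  have hrs := hr.isSmooth_slice hs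
  have hws := hw.isSmooth_slice hs
  have hθs := hθ.isSmooth_slice hs
  have has := ha.isSmooth_slice hs
  have hcs := hc.isSmooth_slice hs
  have hds := hd.isSmooth_slice hs
  have h1 : FunctionSpaces.Torus.IsSmooth (fun x => r s x ^ 2) := hrs.pow 2
  have h2 : FunctionSpaces.Torus.IsSmooth (fun x => ‖w s x‖ ^ 2) := hws.norm_sq
  have h3 : FunctionSpaces.Torus.IsSmooth (fun x => θ s x ^ 2) := hθs.pow 2
  have he : FunctionSpaces.Torus.IsSmooth
      (fun x => a s x * r s x ^ 2 + c s x * ‖w s x‖ ^ 2 + d₃ s x * θ s x ^ 2) :=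
    ((has.mul h1).add (hcs.mul h2)).add (hds.mul h3)
  -- `δ ∫ (component)² ≤ E(s) ≤ 0` for each of the three components
  have key : ∀ {f : UnitAddTorus d → ℝ}, FunctionSpaces.Torus.IsSmooth f → (∀ x, 0 ≤ f x) →
      (∀ x, δ * f x ≤ a s x * r s x ^ 2 + c s x * ‖w s x‖ ^ 2 + d₃ s x * θ s x ^ 2) →
      ∫ x, f x ≤ 0 := by
    intro f hf hf0 hfe
    have hle : ∫ x, δ * f x ≤ ∫ x, (a s x * r s x ^ 2 + c s x * ‖w s x‖ ^ 2 + d₃ s x * θ s x ^ 2) :=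
      integral_mono (hf.integrable.const_mul δ) he.integrable hfe
    rw [integral_const_mul] at hle
    have hf_nn : 0 ≤ ∫ x, f x := integral_nonneg hf0
    nlinarith
  have er : ∀ x, δ * r s x ^ 2 ≤ a s x * r s x ^ 2 + c s x * ‖w s x‖ ^ 2 + d₃ s x * θ s x ^ 2 := by
    intro x
    have i1 := mul_le_mul_of_nonneg_right (hδa s hs x) (sq_nonneg (r s x))
    have i2 := mul_nonneg (hδ.le.trans (hδc s hs x)) (sq_nonneg ‖w s x‖)
    have i3 := mul_nonneg (hδ.le.trans (hδd s hs x)) (sq_nonneg (θ s x))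
    linarith
  have ew : ∀ x, δ * ‖w s x‖ ^ 2 ≤ a s x * r s x ^ 2 + c s x * ‖w s x‖ ^ 2 + d₃ s x * θ s x ^ 2 := by
    intro x
    have i1 := mul_nonneg (hδ.le.trans (hδa s hs x)) (sq_nonneg (r s x))
    have i2 := mul_le_mul_of_nonneg_right (hδc s hs x) (sq_nonneg ‖w s x‖)
    have i3 := mul_nonneg (hδ.le.trans (hδd s hs x)) (sq_nonneg (θ s x))
    linarith
  have eθ : ∀ x, δ * θ s x ^ 2 ≤ a s x * r s x ^ 2 + c s x * ‖w s x‖ ^ 2 + d₃ s x * θ s x ^ 2 := by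
    intro x
    have i1 := mul_nonneg (hδ.le.trans (hδa s hs x)) (sq_nonneg (r s x))
    have i2 := mul_nonneg (hδ.le.trans (hδc s hs x)) (sq_nonneg ‖w s x‖)
    have i3 := mul_le_mul_of_nonneg_right (hδd s hs x) (sq_nonneg (θ s x))
    linarith
  have Ir : ∫ x, ‖r s x‖ ^ 2 ≤ 0 := by
    have := key h1 (fun x => sq_nonneg _) er
    simpa [Real.norm_eq_abs, sq_abs] using this
  have Iw : ∫ x, ‖w s x‖ ^ 2 ≤ 0 := key h2 (fun x => sq_nonneg _) ew
  have Iθ : ∫ x, ‖θ s x‖ ^ 2 ≤ 0 := by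
    have := key h3 (fun x => sq_nonneg _) eθ
    simpa [Real.norm_eq_abs, sq_abs] using this
  exact ⟨FunctionSpaces.Torus.eq_zero_of_integral_norm_sq_nonpos hrs Ir,
    FunctionSpaces.Torus.eq_zero_of_integral_norm_sq_nonpos hws Iw,
    FunctionSpaces.Torus.eq_zero_of_integral_norm_sq_nonpos hθs Iθ⟩

end Gronwall

end CompressibleEuler

end Literature.Analysis.FluidPDE

end
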